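import Summits.NavierStokesRegularity.NavierStokesRegularity.Theorems.ThreadingFluxCentreVirialHodgeMollify
import Summits.NavierStokesRegularity.NavierStokesRegularity.Theorems.ThreadingFluxCentreVirialTame
import HarnessLib

/-!
# Crux `PoloidalLiouville` (stmt-NavierStokesRegularity-1222, W1), crux idea «centre-virial» (ns-idea-15 g9):
# ★★★ (H) `HodgeSlavingShell` AS TYPED (`C¹` fields), by name — via mollification

* `Hodge.hodgeSlavingShell_C1`: `u ∈ C¹(ℝ³; ℝ³)` divergence-free and unthreaded about `x₀`, `0 < a < b` ⇒
  `∫_shell r⁻³|u_tan|² ≤ ½ ∫_shell (∂_r(r²u_r))²/r⁵`: H″ (`hodgeSlavingShell_C2_defect`) for the mollified cut-off fields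
  `u_n = φ_n ⋆ (χu)` (`C^∞`, divergence-free on the shell), then `n → ∞` by dominated convergence on the shell
  (`u_n → u`, `Du_n = φ_n ⋆ D(χu) → Du` pointwise with eventual uniform bounds); the vorticity-defect term tends to
  `∫_shell ⟪curl u, y⟫²/r³ = 0`.
* ★★★ `hodgeSlavingShell : HodgeSlavingShell` — the card's H by name over the twin `ThreadingFluxCentreVirialDefs`
  (`IsDivFree`, `IsUnthreadedAbout` unfold definitionally).

With this file every non-conjecture statement of the centre-virial card (V0, V1, V1′, F1, F2, B, T1, H, T2) is a tree theorem
by name; open remain the conjectures T0 `SteadyPoloidalDLiouville` / Galdi and W1ᴰ (⇐ T0).  Information-grade; W1 movement 0;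
NS regularity is NOT proved.  `--supports stmt-NavierStokesRegularity-1222 --as helper`.  Filed by ns-wall-eng-4 g6.
[cite: KorobkovPileckasRusso2015, Thm 3.6]
-/

-- the summit and its single sub-problem share the name (CONVENTIONS §1)
set_option linter.dupNamespace false

noncomputable section

namespace Summit.NavierStokesRegularity.NavierStokesRegularity.Theorems.PoloidalLiouville.CentreVirial

open Set Function MeasureTheory Filter Topology
open Literature.Analysis.FluidPDE
open Literature.Analysis.FluidPDE.VectorCalculus (divergence IsDivFree)
open Summit.NavierStokesRegularity.NavierStokesRegularity.Theorems.PoloidalLiouville.CentreJet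
  (E3 IsUnthreadedAbout IsSteadyNSOn)
open scoped RealInnerProductSpace

namespace Hodge

section MollifyC1
open scoped Convolution
open ContinuousLinearMap (lsmul)

variable {u : E3 → E3} {x₀ : E3}

/-- ★★★ **Hodge slaving for `C¹` fields — the card's `HodgeSlavingShell` AS TYPED.**  If `u ∈ C¹(ℝ³; ℝ³)` is
divergence-free and unthreaded about `x₀`, then on every shell `0 < a < |y| < b`:
`∫_shell r⁻³|u_tan|² ≤ ½ ∫_shell (∂_r(r²u_r))²/r⁵`.  By mollification: `u_n = φ_n ⋆ (χ u)` is `C²` and divergence-free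
on the shell, H″ (`hodgeSlavingShell_C2_defect`) applies to it, and as `n → ∞` the two sides converge (`u_n → u`,
`Du_n = φ_n ⋆ D(χu) → Du` uniformly on the shell) while the vorticity-defect term tends to `∫ ⟪curl u, y⟫²/r³ = 0`. -/
theorem hodgeSlavingShell_C1 (u : E3 → E3) (x₀ : E3) (a b : ℝ) (hu : ContDiff ℝ 1 u)
    (hdiv : ∀ x, divergence u x = 0) (hunthr : ∀ x, ⟪x - x₀, curl u x⟫ = 0) (ha : 0 < a) (hab : a < b) :
    ∫ x in shell x₀ a b, tanDensity x₀ u x ≤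
      (1 / 2) * ∫ x in shell x₀ a b, radialFluxDeriv x₀ u x ^ 2 / ‖x - x₀‖ ^ 5 := by
  have hb : 0 < b := ha.trans hab
  set v := cutField x₀ b u with hv_def
  have hv : ContDiff ℝ 1 v := cutField_contDiff hu
  have hvc : HasCompactSupport v := cutField_hasCompactSupport hb u
  have hvcont : Continuous v := hv.continuous
  have hDvcont : Continuous (fderiv ℝ v) := hv.continuous_fderiv one_ne_zero
  set U : ℕ → E3 → E3 := fun n => mollify v n with hU_def
  have hU2 : ∀ n, ContDiff ℝ 2 (U n) := fun n => mollify_contDiff hvcont n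
  have hUd : ∀ n x, DifferentiableAt ℝ (U n) x := fun n x => (hU2 n).differentiable (by norm_num) x
  have hDU : ∀ n x, fderiv ℝ (U n) x = ((bumpSeq n).normed volume ⋆[lsmul ℝ ℝ, volume] fderiv ℝ v) x :=
    fun n x => fderiv_mollify hv hvc n x
  -- the shell sits inside `closedBall x₀ b` and inside `ball x₀ (b + 1)`
  have hshellK : ∀ x ∈ shell x₀ a b, x ∈ Metric.closedBall x₀ b ∧ ‖x - x₀‖ < b + 1 ∧ x ≠ x₀ ∧ 0 < ‖x - x₀‖ := by
    intro x hx
    have h1 : a < ‖x - x₀‖ := hx.1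
    have h2 : ‖x - x₀‖ < b := hx.2
    refine ⟨by rw [Metric.mem_closedBall, dist_eq_norm]; exact h2.le, by linarith, fun h => ?_, ha.trans h1⟩
    rw [h, sub_self, norm_zero] at h1; linarith
  -- H″ for each `u_n`
  have keyn : ∀ n, ∫ x in shell x₀ a b, tanDensity x₀ (U n) x ≤
      ((1 / 2) * ∫ x in shell x₀ a b, radialFluxDeriv x₀ (U n) x ^ 2 / ‖x - x₀‖ ^ 5) +
        (1 / 2) * ∫ x in shell x₀ a b, ⟪curl (U n) x, x - x₀⟫ ^ 2 / ‖x - x₀‖ ^ 3 := fun n =>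
    hodgeSlavingShell_C2_defect (U n) x₀ a b (hU2 n)
      (fun x hx => divergence_mollify_cutField hb hu (fun z _ => hdiv z) n hx.2) ha hab
  -- pointwise limits on the shell
  have hlimU : ∀ x ∈ shell x₀ a b, Tendsto (fun n => U n x) atTop (𝓝 (u x)) := by
    intro x hx
    obtain ⟨hxK, hxb, -, -⟩ := hshellK x hx
    have h := tendsto_mollify hvcont (x₀ := x₀) (b := b) hxK
    rwa [show v x = u x from (cutField_eventuallyEq hb hxb).eq_of_nhds] at h
  have hlimDU : ∀ x ∈ shell x₀ a b, Tendsto (fun n => fderiv ℝ (U n) x) atTop (𝓝 (fderiv ℝ u x)) := by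
    intro x hx
    obtain ⟨hxK, hxb, -, -⟩ := hshellK x hx
    have h := tendsto_mollify hDvcont (x₀ := x₀) (b := b) hxK
    rw [show fderiv ℝ v x = fderiv ℝ u x from (cutField_eventuallyEq hb hxb).fderiv_eq] at h
    exact h.congr fun n => (hDU n x).symm
  -- eventual uniform bounds on the shell
  obtain ⟨CU, hCU⟩ := eventually_norm_mollify_le hvcont x₀ b
  obtain ⟨CD, hCD⟩ := eventually_norm_mollify_le hDvcont x₀ b
  have hCU0 : ∀ᶠ n : ℕ in atTop, ∀ x ∈ shell x₀ a b, ‖U n x‖ ≤ CU ∧ ‖fderiv ℝ (U n) x‖ ≤ CD := by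
    filter_upwards [hCU, hCD] with n h1 h2 x hx
    exact ⟨h1 x (hshellK x hx).1, by rw [hDU]; exact h2 x (hshellK x hx).1⟩
  -- the finite measure on the shell
  have hμ : volume (shell x₀ a b) < ⊤ :=
    (measure_mono fun x hx => show x ∈ Metric.closedBall x₀ b from (hshellK x hx).1).trans_lt
      (isCompact_closedBall x₀ b).measure_lt_top
  have hSm := measurableSet_shell x₀ a b
  -- continuity of the integrands on the shell (for measurability)
  have hcontOn : ∀ (w : E3 → E3), ContDiff ℝ 1 w →
      ContinuousOn (fun x => tanDensity x₀ w x) (shell x₀ a b) ∧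
      ContinuousOn (fun x => radialFluxDeriv x₀ w x ^ 2 / ‖x - x₀‖ ^ 5) (shell x₀ a b) ∧
      ContinuousOn (fun x => ⟪curl w x, x - x₀⟫ ^ 2 / ‖x - x₀‖ ^ 3) (shell x₀ a b) := by
    intro w hw
    have hwc : Continuous w := hw.continuous
    have hmc : Continuous (mom x₀ w) := (continuous_id.sub continuous_const).inner hwc
    have hm1 : ContDiff ℝ 1 (mom x₀ w) := (contDiff_id.sub contDiff_const).inner ℝ hw
    have hDc : Continuous (radialFluxDeriv x₀ w) := by
      unfold radialFluxDeriv
      exact hmc.add ((hm1.continuous_fderiv one_ne_zero).clm_apply (continuous_id.sub continuous_const))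
    have hcurlc : Continuous (curl w) := by
      rw [curl_eq_curlCLM_comp]; exact curlCLM.continuous.comp (hw.continuous_fderiv one_ne_zero)
    have hnc : Continuous fun x : E3 => ‖x - x₀‖ := continuous_norm.comp (continuous_id.sub continuous_const)
    have hr0 : ∀ x ∈ shell x₀ a b, ‖x - x₀‖ ≠ 0 := fun x hx => ((hshellK x hx).2.2.2).ne'
    refine ⟨?_, ?_, ?_⟩
    · unfold tanDensity
      exact (((hnc.pow 2).mul (hwc.norm.pow 2)).sub (hmc.pow 2)).continuousOn.div (hnc.pow 5).continuousOn
        fun x hx => pow_ne_zero 5 (hr0 x hx)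
    · exact (hDc.pow 2).continuousOn.div (hnc.pow 5).continuousOn fun x hx => pow_ne_zero 5 (hr0 x hx)
    · exact ((hcurlc.inner (continuous_id.sub continuous_const)).pow 2).continuousOn.div (hnc.pow 3).continuousOn
        fun x hx => pow_ne_zero 3 (hr0 x hx)
  -- (1) the tangential energy
  have hL1 : Tendsto (fun n => ∫ x in shell x₀ a b, tanDensity x₀ (U n) x) atTop
      (𝓝 (∫ x in shell x₀ a b, tanDensity x₀ u x)) := by
    refine tendsto_integral_filter_of_dominated_convergence (fun _ => 2 * b ^ 2 * CU ^ 2 / a ^ 5) ?_ ?_ ?_ ?_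
    · exact Eventually.of_forall fun n => ((hcontOn (U n) ((hU2 n).of_le (by norm_num))).1).aestronglyMeasurable hSm
    · filter_upwards [hCU0] with n hn
      refine (ae_restrict_iff' hSm).2 (Eventually.of_forall fun x hx => ?_)
      obtain ⟨h1, -⟩ := hn x hx
      obtain ⟨-, -, -, hr⟩ := hshellK x hx
      have hrb : ‖x - x₀‖ ≤ b := (hx.2).le
      have hra : a ≤ ‖x - x₀‖ := (hx.1).le
      have hinner : |⟪x - x₀, U n x⟫| ≤ ‖x - x₀‖ * ‖U n x‖ := abs_real_inner_le_norm _ _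
      rw [Real.norm_eq_abs]
      unfold tanDensity mom
      rw [abs_div, abs_of_pos (pow_pos hr 5), div_le_div_iff₀ (pow_pos hr 5) (pow_pos ha 5)]
      have hnum : |‖x - x₀‖ ^ 2 * ‖U n x‖ ^ 2 - ⟪x - x₀, U n x⟫ ^ 2| ≤ 2 * ‖x - x₀‖ ^ 2 * ‖U n x‖ ^ 2 := by
        rw [abs_le]
        constructor <;> nlinarith [sq_nonneg ⟪x - x₀, U n x⟫, sq_abs ⟪x - x₀, U n x⟫, hinner, norm_nonneg (U n x),
          abs_nonneg ⟪x - x₀, U n x⟫]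
      have hU0 : 0 ≤ ‖U n x‖ := norm_nonneg _
      have hCU' : 0 ≤ CU := hU0.trans h1
      calc |‖x - x₀‖ ^ 2 * ‖U n x‖ ^ 2 - ⟪x - x₀, U n x⟫ ^ 2| * a ^ 5
          ≤ 2 * ‖x - x₀‖ ^ 2 * ‖U n x‖ ^ 2 * a ^ 5 := by gcongr
        _ ≤ 2 * b ^ 2 * CU ^ 2 * ‖x - x₀‖ ^ 5 := by
            have e1 : ‖x - x₀‖ ^ 2 ≤ b ^ 2 := pow_le_pow_left₀ hr.le hrb 2
            have e2 : ‖U n x‖ ^ 2 ≤ CU ^ 2 := pow_le_pow_left₀ hU0 h1 2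
            have e3 : a ^ 5 ≤ ‖x - x₀‖ ^ 5 := pow_le_pow_left₀ ha.le hra 5
            have := mul_le_mul (mul_le_mul e1 e2 (sq_nonneg _) (sq_nonneg _)) e3 (pow_nonneg ha.le 5)
              (mul_nonneg (sq_nonneg _) (sq_nonneg _))
            nlinarith [this]
    · exact integrableOn_const hμ.ne
    · refine (ae_restrict_iff' hSm).2 (Eventually.of_forall fun x hx => ?_)
      have hUx := hlimU x hx
      unfold tanDensity mom
      exact ((((tendsto_const_nhds.mul ((hUx.norm).pow 2)).sub
        ((tendsto_const_nhds.inner hUx).pow 2)).div_const _))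
  -- (2) the radial-flux term
  have hL2 : Tendsto (fun n => ∫ x in shell x₀ a b, radialFluxDeriv x₀ (U n) x ^ 2 / ‖x - x₀‖ ^ 5) atTop
      (𝓝 (∫ x in shell x₀ a b, radialFluxDeriv x₀ u x ^ 2 / ‖x - x₀‖ ^ 5)) := by
    refine tendsto_integral_filter_of_dominated_convergence (fun _ => (2 * b * CU + b ^ 2 * CD) ^ 2 / a ^ 5) ?_ ?_ ?_ ?_
    · exact Eventually.of_forall fun n => ((hcontOn (U n) ((hU2 n).of_le (by norm_num))).2.1).aestronglyMeasurable hSm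
    · filter_upwards [hCU0] with n hn
      refine (ae_restrict_iff' hSm).2 (Eventually.of_forall fun x hx => ?_)
      obtain ⟨h1, h2⟩ := hn x hx
      obtain ⟨-, -, -, hr⟩ := hshellK x hx
      have hrb : ‖x - x₀‖ ≤ b := (hx.2).le
      have hra : a ≤ ‖x - x₀‖ := (hx.1).le
      rw [Real.norm_eq_abs, abs_div, abs_of_pos (pow_pos hr 5), radialFluxDeriv_eq (hUd n x)]
      have hA : |2 * ⟪x - x₀, U n x⟫ + ⟪x - x₀, fderiv ℝ (U n) x (x - x₀)⟫| ≤ 2 * b * CU + b ^ 2 * CD := by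
        have i1 : |⟪x - x₀, U n x⟫| ≤ ‖x - x₀‖ * ‖U n x‖ := abs_real_inner_le_norm _ _
        have i2 : |⟪x - x₀, fderiv ℝ (U n) x (x - x₀)⟫| ≤ ‖x - x₀‖ * ‖fderiv ℝ (U n) x (x - x₀)‖ :=
          abs_real_inner_le_norm _ _
        have i3 : ‖fderiv ℝ (U n) x (x - x₀)‖ ≤ ‖fderiv ℝ (U n) x‖ * ‖x - x₀‖ := ContinuousLinearMap.le_opNorm _ _
        have hU0 : 0 ≤ ‖U n x‖ := norm_nonneg _
        have hD0 : 0 ≤ ‖fderiv ℝ (U n) x‖ := norm_nonneg _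
        have hCUnn : 0 ≤ CU := hU0.trans h1
        have hCDnn : 0 ≤ CD := hD0.trans h2
        calc |2 * ⟪x - x₀, U n x⟫ + ⟪x - x₀, fderiv ℝ (U n) x (x - x₀)⟫|
            ≤ 2 * |⟪x - x₀, U n x⟫| + |⟪x - x₀, fderiv ℝ (U n) x (x - x₀)⟫| := by
              calc _ ≤ |2 * ⟪x - x₀, U n x⟫| + |⟪x - x₀, fderiv ℝ (U n) x (x - x₀)⟫| := abs_add_le _ _
                _ = _ := by rw [abs_mul, abs_two]
          _ ≤ 2 * (‖x - x₀‖ * ‖U n x‖) + ‖x - x₀‖ * (‖fderiv ℝ (U n) x‖ * ‖x - x₀‖) := by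
              gcongr
              exact i2.trans (mul_le_mul_of_nonneg_left i3 (norm_nonneg _))
          _ ≤ 2 * (b * CU) + b * (CD * b) := by
              have e1 : ‖x - x₀‖ * ‖U n x‖ ≤ b * CU := mul_le_mul hrb h1 hU0 hb.le
              have e2 : ‖fderiv ℝ (U n) x‖ * ‖x - x₀‖ ≤ CD * b := mul_le_mul h2 hrb hr.le hCDnn
              have e3 : ‖x - x₀‖ * (‖fderiv ℝ (U n) x‖ * ‖x - x₀‖) ≤ b * (CD * b) :=
                mul_le_mul hrb e2 (mul_nonneg hD0 hr.le) hb.le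
              linarith
          _ = 2 * b * CU + b ^ 2 * CD := by ring
      have hsq : (2 * ⟪x - x₀, U n x⟫ + ⟪x - x₀, fderiv ℝ (U n) x (x - x₀)⟫) ^ 2 ≤ (2 * b * CU + b ^ 2 * CD) ^ 2 := by
        have h0 : 0 ≤ |2 * ⟪x - x₀, U n x⟫ + ⟪x - x₀, fderiv ℝ (U n) x (x - x₀)⟫| := abs_nonneg _
        have := pow_le_pow_left₀ h0 hA 2
        rwa [sq_abs] at this
      rw [abs_of_nonneg (sq_nonneg _), div_le_div_iff₀ (pow_pos hr 5) (pow_pos ha 5)]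
      have e3 : a ^ 5 ≤ ‖x - x₀‖ ^ 5 := pow_le_pow_left₀ ha.le hra 5
      exact mul_le_mul hsq e3 (pow_nonneg ha.le 5) (sq_nonneg _)
    · exact integrableOn_const hμ.ne
    · refine (ae_restrict_iff' hSm).2 (Eventually.of_forall fun x hx => ?_)
      have hUx := hlimU x hx
      have hDUx := hlimDU x hx
      have hud : DifferentiableAt ℝ u x := hu.differentiable one_ne_zero x
      rw [radialFluxDeriv_eq hud]
      have e : (fun n => radialFluxDeriv x₀ (U n) x ^ 2 / ‖x - x₀‖ ^ 5) =
          fun n => (2 * ⟪x - x₀, U n x⟫ + ⟪x - x₀, fderiv ℝ (U n) x (x - x₀)⟫) ^ 2 / ‖x - x₀‖ ^ 5 := by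
        funext n; rw [radialFluxDeriv_eq (hUd n x)]
      rw [e]
      have hDUy : Tendsto (fun n => fderiv ℝ (U n) x (x - x₀)) atTop (𝓝 (fderiv ℝ u x (x - x₀))) :=
        (ContinuousLinearMap.apply ℝ E3 (x - x₀)).continuous.tendsto _ |>.comp hDUx
      exact (((tendsto_const_nhds.mul (tendsto_const_nhds.inner hUx)).add (tendsto_const_nhds.inner hDUy)).pow 2).div_const _
  -- (3) the vorticity defect: tends to `∫ ⟪curl u, y⟫²/r³ = 0`
  have hL3 : Tendsto (fun n => ∫ x in shell x₀ a b, ⟪curl (U n) x, x - x₀⟫ ^ 2 / ‖x - x₀‖ ^ 3) atTop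
      (𝓝 (∫ x in shell x₀ a b, ⟪curl u x, x - x₀⟫ ^ 2 / ‖x - x₀‖ ^ 3)) := by
    refine tendsto_integral_filter_of_dominated_convergence (fun _ => (‖curlCLM‖ * CD * b) ^ 2 / a ^ 3) ?_ ?_ ?_ ?_
    · exact Eventually.of_forall fun n => ((hcontOn (U n) ((hU2 n).of_le (by norm_num))).2.2).aestronglyMeasurable hSm
    · filter_upwards [hCU0] with n hn
      refine (ae_restrict_iff' hSm).2 (Eventually.of_forall fun x hx => ?_)
      obtain ⟨-, h2⟩ := hn x hx
      obtain ⟨-, -, -, hr⟩ := hshellK x hx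
      have hrb : ‖x - x₀‖ ≤ b := (hx.2).le
      have hra : a ≤ ‖x - x₀‖ := (hx.1).le
      rw [Real.norm_eq_abs, abs_div, abs_of_pos (pow_pos hr 3), abs_of_nonneg (sq_nonneg _),
        div_le_div_iff₀ (pow_pos hr 3) (pow_pos ha 3)]
      have i1 : |⟪curl (U n) x, x - x₀⟫| ≤ ‖curl (U n) x‖ * ‖x - x₀‖ := abs_real_inner_le_norm _ _
      have i2 : ‖curl (U n) x‖ ≤ ‖curlCLM‖ * ‖fderiv ℝ (U n) x‖ := norm_curl_le _ _
      have hc0 : (0 : ℝ) ≤ ‖(curlCLM : (E3 →L[ℝ] E3) →L[ℝ] E3)‖ := ContinuousLinearMap.opNorm_nonneg _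
      have hA : |⟪curl (U n) x, x - x₀⟫| ≤ ‖curlCLM‖ * CD * b := by
        calc |⟪curl (U n) x, x - x₀⟫| ≤ ‖curl (U n) x‖ * ‖x - x₀‖ := i1
          _ ≤ (‖curlCLM‖ * ‖fderiv ℝ (U n) x‖) * b := mul_le_mul i2 hrb hr.le (by positivity)
          _ ≤ (‖curlCLM‖ * CD) * b := by gcongr
      have hsq : ⟪curl (U n) x, x - x₀⟫ ^ 2 ≤ (‖curlCLM‖ * CD * b) ^ 2 := by
        have h0 : 0 ≤ |⟪curl (U n) x, x - x₀⟫| := abs_nonneg _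
        have := pow_le_pow_left₀ h0 hA 2
        rwa [sq_abs] at this
      have e3 : a ^ 3 ≤ ‖x - x₀‖ ^ 3 := pow_le_pow_left₀ ha.le hra 3
      exact mul_le_mul hsq e3 (pow_nonneg ha.le 3) (sq_nonneg _)
    · exact integrableOn_const hμ.ne
    · refine (ae_restrict_iff' hSm).2 (Eventually.of_forall fun x hx => ?_)
      have hDUx := hlimDU x hx
      have hcurl : Tendsto (fun n => curl (U n) x) atTop (𝓝 (curl u x)) := by
        simp only [curl_eq_curlCLM]
        exact (curlCLM.continuous.tendsto _).comp hDUx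
      exact ((hcurl.inner tendsto_const_nhds).pow 2).div_const _
  have hzero : ∫ x in shell x₀ a b, ⟪curl u x, x - x₀⟫ ^ 2 / ‖x - x₀‖ ^ 3 = 0 := by
    refine setIntegral_eq_zero_of_forall_eq_zero fun x _ => ?_
    rw [real_inner_comm, hunthr x]
    simp
  rw [hzero] at hL3
  have hR := (hL2.const_mul (1 / 2)).add (hL3.const_mul (1 / 2))
  rw [mul_zero, add_zero] at hR
  exact le_of_tendsto_of_tendsto' hL1 hR keyn

end MollifyC1

end Hodge

/-! ## H by name -/

section HbyName

open Literature.Analysis.FluidPDE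

/-- ★★★ **(H) `HodgeSlavingShell` — AS TYPED (binder `C¹`), by name.**  If `u ∈ C¹(ℝ³; ℝ³)` is divergence-free and
unthreaded about `x₀` then on every shell `0 < a < |y| < b`: `∫_shell r⁻³|u_tan|² ≤ ½∫_shell (∂_r(r²u_r))²/r⁵`
(`Hodge.hodgeSlavingShell_C1`: the sphere-free Bochner inequality with vorticity defect for `C²` fields, transported to `C¹`
fields by mollification).  The card's sphere-wise statement (`u_tan = ∇_S ψ`, `λ₁(S_r) = 2/r²`) integrated over the
shell; no surface measure is used anywhere. [cite: KorobkovPileckasRusso2015, Thm 3.6] -/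
theorem hodgeSlavingShell : HodgeSlavingShell := fun u x₀ a b hu hdiv hU ha hab =>
  Hodge.hodgeSlavingShell_C1 u x₀ a b hu hdiv hU ha hab

end HbyName

end Summit.NavierStokesRegularity.NavierStokesRegularity.Theorems.PoloidalLiouville.CentreVirial
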